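import Summits.AtomisticToContinuum.HydrodynamicLimit.Theorems.TwoClocksEquilibriumFastWindowLDBirthT12ThalesGain
import Summits.AtomisticToContinuum.HydrodynamicLimit.Theorems.TwoClocksEquilibriumFastWindowLDBirthT12Indicial
import HarnessLib

/-!
# The far-field ("Lorentz-gas") gain operator of the linearised hard-sphere operator of `ℝ³`
# (helpers `t12_lorentzGain_rpow`, `t12_lorentzGain_abs_le` of the line `birth`, crux
# `TwoClocks.EquilibriumFastWindowLD`, stmt-AtomisticToContinuum-14440; FF1 completion step 1 towards the
# registered analytic sub-goal `t12_logLinearPreimage_and_dipoleModulus` — FACT F of the corrector-growth plan)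

The gain term of the linearised hard-sphere operator `L = K₂ - K₁ - ν` of `ℝ³` (`M`-weighted picture,
`kernelAction_eq_pieces_of_gaussGrowth`) is `(K₂u)(v) = ∫ dM(w) ∫_{S²} ((v-w)·ω)₊ [u(v') + u(w')] dσ(ω)`.
At large speed `s = ‖v‖` the Maxwellian partner `w` is at rest to relative accuracy `O(1/s)`; FREEZING it
at `w = 0` in the exact Lambert-disc representation of the two inner integrals (`t12_gainFst_disc`,
`t12_gainSnd_disc` of `…T12ThalesGain`) defines the **far-field (Lorentz-gas) gain operator**

  `lorentzGain u v := ‖v‖ · ( ∫_{‖p‖<1} u(‖p‖² v - ‖v‖√(1-‖p‖²) E_v p) dp + ∫_{‖p‖<1} u((1-‖p‖²) v + ‖v‖√(1-‖p‖²) E_v p) dp )`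

(`p ∈ ℝ²` Lebesgue, `E_v := Lambert.embed (‖v‖⁻¹ v)` the tree's isometry `ℝ² ≅ v^⊥`): the own particle
`v' = v - (v·ω)ω` and the recoiling field particle `w' = (v·ω)ω` run over the Thales sphere
`{x : ‖x‖² = ⟪x, v⟫}` of `[0, v]`, at distances `‖p‖·‖v‖` resp. `√(1-‖p‖²)·‖v‖` from the origin
(`norm_thalesFst`, `norm_thalesSnd`). This file proves:

* **the specialisation lemma** `gain_zero_eq_lorentzGain`: for EVERY measurable `u` (no integrability),
  `∫_{S²} (v·ω)₊ u(v') dσ + ∫_{S²} (v·ω)₊ u(w') dσ = lorentzGain u v` at partner `w = 0` — the true gain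
  term with the partner frozen at rest IS `lorentzGain` (pieces `gainFst_zero_eq_disc`, `gainSnd_zero_eq_disc`);
* **the action on radial functions** `lorentzGain_radial`: `lorentzGain (f ∘ ‖·‖) v = π‖v‖ · 2∫₀¹ 2ρ f(ρ‖v‖) dρ`
  (both radius ratios have the law `2ρ dρ`: `t12_fluxMeasure_map_radiusFst`, `fluxMeasure_map_radiusSnd`), hence
  the registered **`t12_lorentzGain_rpow`: `lorentzGain (‖·‖^α) v = λ₀(α) · π‖v‖^{α+1}`, `λ₀(α) = 4/(α+2)`**
  (`-1 < α`; the monopole column of the resonance table of `…T12Indicial`, now as an operator identity), with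
  the first two entries **`lorentzGain 1 v = 2π‖v‖`** (mass `λ₀(0) = 2`: `K₂1 = 2ν` to leading order) and
  **`lorentzGain ‖·‖ v = (4/3)π‖v‖²`** (`λ₀(1) = 4/3 > 1`: the obstruction to positive supersolutions of
  linear growth, plan §3);
* **positivity, monotonicity, linearity** (`lorentzGain_nonneg`, `lorentzGain_mono`, `abs_lorentzGain_le`,
  `lorentzGain_const_mul`, `lorentzGain_add`) and the registered **weighted bound `t12_lorentzGain_abs_le`**:
  `|u(x)| ≤ m(1 + ‖x‖)` ⟹ `|lorentzGain u v| ≤ π‖v‖·m·(2 + (4/3)‖v‖)` — the sharp structure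
  `π s · m · 2∫₀¹ 2ρ (1 + ρ s) dρ`.

NOT here: the comparison of the true gain term (`w ∼ M`) with `lorentzGain` (`w = 0`). For a general
bounded measurable `u` no pointwise comparison `|K₂u(v) - lorentzGain u v| = O(m(1+‖v‖))` can hold (the
Lorentz law of the argument of `u` is carried by the Thales sphere, a Lebesgue-null set, while the true
law is absolutely continuous); the comparison is made on the radial weights `1`, `‖x‖` in the sibling file
`…T12LorentzB` and, for the iterated angular kernels, in FF1/FF2 of the plan. All statements are [folklore]
(far-field / Lorentz-gas limit of the hard-sphere gain term: Grad 1963 §4; Cercignani–Illner–Pulvirenti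
1994 §7.2; FACT F of the corrector-growth plan of the line `birth`).
-/

noncomputable section

open MeasureTheory Real Set Filter Metric
open scoped ENNReal BigOperators InnerProductSpace
namespace Summit.AtomisticToContinuum.HydrodynamicLimit.Theorems.ClampedCorrectorBirth

open Literature.Analysis.FluidPDE Literature.MathematicalPhysics.KineticTheory

/-! ### The operator and the specialisation `w = 0` of the disc representation -/

/-- **The far-field (Lorentz-gas) gain operator** of the linearised hard-sphere operator of `ℝ³`:
`lorentzGain u v = ‖v‖ (∫_{‖p‖<1} u(‖p‖² v - ‖v‖√(1-‖p‖²) E_v p) dp + ∫_{‖p‖<1} u((1-‖p‖²) v + ‖v‖√(1-‖p‖²) E_v p) dp)`,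
`E_v = Lambert.embed (‖v‖⁻¹ • v)` — the exact Lambert-disc representation of the gain term
(`t12_gainFst_disc` + `t12_gainSnd_disc`) with the Maxwellian partner frozen at rest, `w = 0`
(FACT F of the corrector-growth plan; in polar coordinates `π‖v‖ ∫₀¹ 4ρ (A_ρ u(ρ‖v‖ ·))(v̂) dρ`). [folklore] -/
def lorentzGain (u : EuclideanSpace ℝ (Fin 3) → ℝ) (v : EuclideanSpace ℝ (Fin 3)) : ℝ :=
  ‖v‖ * ((∫ p in ball (0 : EuclideanSpace ℝ (Fin 2)) 1,
      u ((‖p‖ ^ 2) • v - (‖v‖ * √(1 - ‖p‖ ^ 2)) • Lambert.embed (‖v‖⁻¹ • v) p)) +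
    ∫ p in ball (0 : EuclideanSpace ℝ (Fin 2)) 1,
      u ((1 - ‖p‖ ^ 2) • v + (‖v‖ * √(1 - ‖p‖ ^ 2)) • Lambert.embed (‖v‖⁻¹ • v) p))

variable {u u' : EuclideanSpace ℝ (Fin 3) → ℝ} {v : EuclideanSpace ℝ (Fin 3)}

/-- At `v = 0` the far-field gain vanishes (no flux). [folklore] -/
theorem lorentzGain_zero_right (u : EuclideanSpace ℝ (Fin 3) → ℝ) : lorentzGain u 0 = 0 := by
  simp [lorentzGain]

/-- **Own piece at partner rest**: `∫_{S²} (v·ω)₊ u(v') dσ(ω) = ‖v‖ ∫_{‖p‖<1} u(‖p‖² v - ‖v‖√(1-‖p‖²) E_v p) dp`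
for every measurable `u` (`t12_gainFst_disc` at `w = 0`). [folklore] -/
theorem gainFst_zero_eq_disc (v : EuclideanSpace ℝ (Fin 3)) (hu : Measurable u) :
    ∫ ω, hardSphereKernel (v, 0) ω * u (collide ω (v, 0)).1 ∂sphereMeasure =
      ‖v‖ * ∫ p in ball (0 : EuclideanSpace ℝ (Fin 2)) 1,
        u ((‖p‖ ^ 2) • v - (‖v‖ * √(1 - ‖p‖ ^ 2)) • Lambert.embed (‖v‖⁻¹ • v) p) := by
  simpa using t12_gainFst_disc v 0 u hu

/-- **Partner piece at partner rest**: `∫_{S²} (v·ω)₊ u(w') dσ(ω) = ‖v‖ ∫_{‖p‖<1} u((1-‖p‖²) v + ‖v‖√(1-‖p‖²) E_v p) dp`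
for every measurable `u` (`t12_gainSnd_disc` at `w = 0`). [folklore] -/
theorem gainSnd_zero_eq_disc (v : EuclideanSpace ℝ (Fin 3)) (hu : Measurable u) :
    ∫ ω, hardSphereKernel (v, 0) ω * u (collide ω (v, 0)).2 ∂sphereMeasure =
      ‖v‖ * ∫ p in ball (0 : EuclideanSpace ℝ (Fin 2)) 1,
        u ((1 - ‖p‖ ^ 2) • v + (‖v‖ * √(1 - ‖p‖ ^ 2)) • Lambert.embed (‖v‖⁻¹ • v) p) := by
  simpa using t12_gainSnd_disc v 0 u hu

/-- **Specialisation lemma (FACT F): the gain term with the partner frozen at rest is `lorentzGain`.**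
For every measurable `u : ℝ³ → ℝ` and every `v` (no integrability needed),
`∫_{S²} (v·ω)₊ u(v') dσ(ω) + ∫_{S²} (v·ω)₊ u(w') dσ(ω) = lorentzGain u v`, `(v', w') = collide ω (v, 0)`. [folklore] -/
theorem gain_zero_eq_lorentzGain (v : EuclideanSpace ℝ (Fin 3)) (hu : Measurable u) :
    (∫ ω, hardSphereKernel (v, 0) ω * u (collide ω (v, 0)).1 ∂sphereMeasure) +
        ∫ ω, hardSphereKernel (v, 0) ω * u (collide ω (v, 0)).2 ∂sphereMeasure = lorentzGain u v := by
  rw [gainFst_zero_eq_disc v hu, gainSnd_zero_eq_disc v hu, lorentzGain, mul_add]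

/-! ### The Thales points at partner rest -/

/-- `E_v p ⟂ v`. [folklore] -/
theorem inner_embed_dir (v : EuclideanSpace ℝ (Fin 3)) (p : EuclideanSpace ℝ (Fin 2)) :
    ⟪v, Lambert.embed (‖v‖⁻¹ • v) p⟫_ℝ = 0 := by
  have h := Lambert.inner_embed_self (‖v‖⁻¹ • v) p
  rw [real_inner_smul_right] at h
  rcases mul_eq_zero.1 h with h0 | h0
  · rw [inv_eq_zero, norm_eq_zero] at h0
    rw [h0, inner_zero_left]
  · rw [real_inner_comm]; exact h0

/-- `‖E_v p‖ = ‖p‖` for `v ≠ 0`. [folklore] -/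
theorem norm_embed_dir (hv : v ≠ 0) (p : EuclideanSpace ℝ (Fin 2)) : ‖Lambert.embed (‖v‖⁻¹ • v) p‖ = ‖p‖ :=
  Lambert.norm_embed (norm_smul_inv_norm hv) p

/-- **Radius of the own Thales point**: `‖‖p‖² v - ‖v‖√(1-‖p‖²) E_v p‖ = ‖v‖·‖p‖` (`‖p‖ ≤ 1`). [folklore] -/
theorem norm_thalesFst (v : EuclideanSpace ℝ (Fin 3)) {p : EuclideanSpace ℝ (Fin 2)} (hp : ‖p‖ ≤ 1) :
    ‖(‖p‖ ^ 2) • v - (‖v‖ * √(1 - ‖p‖ ^ 2)) • Lambert.embed (‖v‖⁻¹ • v) p‖ = ‖v‖ * ‖p‖ := by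
  rcases eq_or_ne v 0 with rfl | hv
  · simp
  have hσ : √(1 - ‖p‖ ^ 2) ^ 2 = 1 - ‖p‖ ^ 2 := sq_sqrt (by nlinarith [norm_nonneg p])
  have key : ‖(‖p‖ ^ 2) • v - (‖v‖ * √(1 - ‖p‖ ^ 2)) • Lambert.embed (‖v‖⁻¹ • v) p‖ ^ 2 =
      (‖v‖ * ‖p‖) ^ 2 := by
    rw [norm_sub_sq_real, real_inner_smul_left, real_inner_smul_right, inner_embed_dir, norm_smul, norm_smul,
      norm_embed_dir hv, Real.norm_of_nonneg (sq_nonneg _), Real.norm_of_nonneg (by positivity)]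
    linear_combination (‖v‖ ^ 2 * ‖p‖ ^ 2) * hσ
  exact (pow_left_inj₀ (norm_nonneg _) (by positivity) two_ne_zero).1 key

/-- **Radius of the partner Thales point**: `‖(1-‖p‖²) v + ‖v‖√(1-‖p‖²) E_v p‖ = ‖v‖·√(1-‖p‖²)` (`‖p‖ ≤ 1`).
[folklore] -/
theorem norm_thalesSnd (v : EuclideanSpace ℝ (Fin 3)) {p : EuclideanSpace ℝ (Fin 2)} (hp : ‖p‖ ≤ 1) :
    ‖(1 - ‖p‖ ^ 2) • v + (‖v‖ * √(1 - ‖p‖ ^ 2)) • Lambert.embed (‖v‖⁻¹ • v) p‖ = ‖v‖ * √(1 - ‖p‖ ^ 2) := by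
  rcases eq_or_ne v 0 with rfl | hv
  · simp
  have h1 : 0 ≤ 1 - ‖p‖ ^ 2 := by nlinarith [norm_nonneg p]
  have hσ : √(1 - ‖p‖ ^ 2) ^ 2 = 1 - ‖p‖ ^ 2 := sq_sqrt h1
  have key : ‖(1 - ‖p‖ ^ 2) • v + (‖v‖ * √(1 - ‖p‖ ^ 2)) • Lambert.embed (‖v‖⁻¹ • v) p‖ ^ 2 =
      (‖v‖ * √(1 - ‖p‖ ^ 2)) ^ 2 := by
    rw [norm_add_sq_real, real_inner_smul_left, real_inner_smul_right, inner_embed_dir, norm_smul, norm_smul,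
      norm_embed_dir hv, Real.norm_of_nonneg h1, Real.norm_of_nonneg (by positivity)]
    linear_combination (‖v‖ ^ 2 * ‖p‖ ^ 2 - ‖v‖ ^ 2) * hσ
  exact (pow_left_inj₀ (norm_nonneg _) (by positivity) two_ne_zero).1 key

/-- The own Thales point stays in the closed ball of radius `‖v‖` (`‖p‖ ≤ 1`). [folklore] -/
theorem norm_thalesFst_le (v : EuclideanSpace ℝ (Fin 3)) {p : EuclideanSpace ℝ (Fin 2)} (hp : ‖p‖ ≤ 1) :
    ‖(‖p‖ ^ 2) • v - (‖v‖ * √(1 - ‖p‖ ^ 2)) • Lambert.embed (‖v‖⁻¹ • v) p‖ ≤ ‖v‖ := by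
  rw [norm_thalesFst v hp]
  exact mul_le_of_le_one_right (norm_nonneg _) hp

/-- The partner Thales point stays in the closed ball of radius `‖v‖` (`‖p‖ ≤ 1`). [folklore] -/
theorem norm_thalesSnd_le (v : EuclideanSpace ℝ (Fin 3)) {p : EuclideanSpace ℝ (Fin 2)} (hp : ‖p‖ ≤ 1) :
    ‖(1 - ‖p‖ ^ 2) • v + (‖v‖ * √(1 - ‖p‖ ^ 2)) • Lambert.embed (‖v‖⁻¹ • v) p‖ ≤ ‖v‖ := by
  rw [norm_thalesSnd v hp]
  exact mul_le_of_le_one_right (norm_nonneg _) (sqrt_le_one.2 (by nlinarith [norm_nonneg p]))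

/-- **Integrability of the own piece** for `u` measurable and bounded on bounded sets. [folklore] -/
theorem integrableOn_comp_thalesFst (v : EuclideanSpace ℝ (Fin 3)) (hu : Measurable u)
    (hb : ∀ R : ℝ, ∃ C : ℝ, ∀ x, ‖x‖ ≤ R → |u x| ≤ C) :
    IntegrableOn (fun p : EuclideanSpace ℝ (Fin 2) =>
      u ((‖p‖ ^ 2) • v - (‖v‖ * √(1 - ‖p‖ ^ 2)) • Lambert.embed (‖v‖⁻¹ • v) p))
      (ball (0 : EuclideanSpace ℝ (Fin 2)) 1) := by
  obtain ⟨C, hC⟩ := hb ‖v‖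
  have hP : Measurable fun p : EuclideanSpace ℝ (Fin 2) =>
      (‖p‖ ^ 2) • v - (‖v‖ * √(1 - ‖p‖ ^ 2)) • Lambert.embed (‖v‖⁻¹ • v) p := by
    unfold Lambert.embed; fun_prop
  refine Measure.integrableOn_of_bounded (M := C) measure_ball_lt_top.ne (hu.comp hP).aestronglyMeasurable
    ((ae_restrict_iff' measurableSet_ball).2 (Eventually.of_forall fun p hp => ?_))
  rw [Real.norm_eq_abs]
  exact hC _ (norm_thalesFst_le v (le_of_lt (mem_ball_zero_iff.1 hp)))

/-- **Integrability of the partner piece** for `u` measurable and bounded on bounded sets. [folklore] -/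
theorem integrableOn_comp_thalesSnd (v : EuclideanSpace ℝ (Fin 3)) (hu : Measurable u)
    (hb : ∀ R : ℝ, ∃ C : ℝ, ∀ x, ‖x‖ ≤ R → |u x| ≤ C) :
    IntegrableOn (fun p : EuclideanSpace ℝ (Fin 2) =>
      u ((1 - ‖p‖ ^ 2) • v + (‖v‖ * √(1 - ‖p‖ ^ 2)) • Lambert.embed (‖v‖⁻¹ • v) p))
      (ball (0 : EuclideanSpace ℝ (Fin 2)) 1) := by
  obtain ⟨C, hC⟩ := hb ‖v‖
  have hP : Measurable fun p : EuclideanSpace ℝ (Fin 2) =>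
      (1 - ‖p‖ ^ 2) • v + (‖v‖ * √(1 - ‖p‖ ^ 2)) • Lambert.embed (‖v‖⁻¹ • v) p := by
    unfold Lambert.embed; fun_prop
  refine Measure.integrableOn_of_bounded (M := C) measure_ball_lt_top.ne (hu.comp hP).aestronglyMeasurable
    ((ae_restrict_iff' measurableSet_ball).2 (Eventually.of_forall fun p hp => ?_))
  rw [Real.norm_eq_abs]
  exact hC _ (norm_thalesSnd_le v (le_of_lt (mem_ball_zero_iff.1 hp)))

/-- Linear growth `|u| ≤ m(1 + ‖·‖)` forces `0 ≤ m` and boundedness on bounded sets. [folklore] -/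
theorem locBdd_of_linearGrowth {m : ℝ} (hm : ∀ x, |u x| ≤ m * (1 + ‖x‖)) :
    0 ≤ m ∧ ∀ R : ℝ, ∃ C : ℝ, ∀ x, ‖x‖ ≤ R → |u x| ≤ C := by
  have hm0 : 0 ≤ m := by
    have h := hm 0
    rw [norm_zero, add_zero, mul_one] at h
    exact (abs_nonneg _).trans h
  exact ⟨hm0, fun R => ⟨m * (1 + R), fun x hx => (hm x).trans (by gcongr)⟩⟩

/-- **Single-integral form**: for `u` measurable and bounded on bounded sets,
`lorentzGain u v = ‖v‖ ∫_{‖p‖<1} [u(own Thales point) + u(partner Thales point)] dp`. [folklore] -/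
theorem lorentzGain_eq_norm_mul_integral_add (v : EuclideanSpace ℝ (Fin 3)) (hu : Measurable u)
    (hb : ∀ R : ℝ, ∃ C : ℝ, ∀ x, ‖x‖ ≤ R → |u x| ≤ C) :
    lorentzGain u v = ‖v‖ * ∫ p in ball (0 : EuclideanSpace ℝ (Fin 2)) 1,
      (u ((‖p‖ ^ 2) • v - (‖v‖ * √(1 - ‖p‖ ^ 2)) • Lambert.embed (‖v‖⁻¹ • v) p) +
        u ((1 - ‖p‖ ^ 2) • v + (‖v‖ * √(1 - ‖p‖ ^ 2)) • Lambert.embed (‖v‖⁻¹ • v) p)) := by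
  rw [lorentzGain, integral_add (integrableOn_comp_thalesFst v hu hb) (integrableOn_comp_thalesSnd v hu hb)]

/-! ### Radial functions: the law `2ρ dρ` of both radius ratios -/

/-- **Own piece on radial functions**: `∫_{S²} (v·ω)₊ f(‖v'‖) dσ(ω) = π‖v‖ ∫₀¹ 2ρ f(ρ‖v‖) dρ` for every
measurable `f` (the radius ratio `‖v'‖/‖v‖` has the law `2ρ dρ`: `t12_fluxMeasure_map_radiusFst`). [folklore] -/
theorem gainFst_zero_radial (v : EuclideanSpace ℝ (Fin 3)) {f : ℝ → ℝ} (hf : Measurable f) :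
    ∫ ω, hardSphereKernel (v, 0) ω * f ‖(collide ω (v, 0)).1‖ ∂sphereMeasure =
      π * ‖v‖ * ∫ ρ in (0:ℝ)..1, 2 * ρ * f (ρ * ‖v‖) := by
  rcases eq_or_ne v 0 with rfl | hv
  · simp [hardSphereKernel]
  have hs : ‖v‖ ≠ 0 := norm_ne_zero_iff.2 hv
  have hF : AEStronglyMeasurable (fun ρ : ℝ => f (ρ * ‖v‖)) (volume.restrict (Icc (0:ℝ) 1)) :=
    (hf.comp (measurable_id.mul_const _)).aestronglyMeasurable
  have h := integral_hardSphereKernel_smul_comp_radiusFst v 0 hF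
  simp only [sub_zero, smul_eq_mul, div_mul_cancel₀ _ hs] at h
  rw [h, mul_assoc]

/-- **Partner piece on radial functions**: `∫_{S²} (v·ω)₊ f(‖w'‖) dσ(ω) = π‖v‖ ∫₀¹ 2ρ f(ρ‖v‖) dρ` for every
measurable `f` (the radius ratio `‖w'‖/‖v‖` has the SAME law `2ρ dρ`: `fluxMeasure_map_radiusSnd`). [folklore] -/
theorem gainSnd_zero_radial (v : EuclideanSpace ℝ (Fin 3)) {f : ℝ → ℝ} (hf : Measurable f) :
    ∫ ω, hardSphereKernel (v, 0) ω * f ‖(collide ω (v, 0)).2‖ ∂sphereMeasure =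
      π * ‖v‖ * ∫ ρ in (0:ℝ)..1, 2 * ρ * f (ρ * ‖v‖) := by
  rcases eq_or_ne v 0 with rfl | hv
  · simp [hardSphereKernel]
  have hs : ‖v‖ ≠ 0 := norm_ne_zero_iff.2 hv
  have hF : AEStronglyMeasurable (fun ρ : ℝ => f (ρ * ‖v‖)) (volume.restrict (Icc (0:ℝ) 1)) :=
    (hf.comp (measurable_id.mul_const _)).aestronglyMeasurable
  have h := integral_hardSphereKernel_smul_comp_radiusSnd v 0 hF
  simp only [sub_zero, smul_eq_mul, div_mul_cancel₀ _ hs] at h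
  rw [h, mul_assoc]

/-- **The far-field gain on radial functions**: for every measurable `f : ℝ → ℝ`,
`lorentzGain (f ∘ ‖·‖) v = π‖v‖ · 2 ∫₀¹ 2ρ f(ρ‖v‖) dρ` — own and partner pieces contribute `2ρ` each, the
factor `4ρ` of FACT F (`(ν⁻¹K₂^∞ u)(s n) = ∫₀¹ 4ρ (A_ρ u(ρ s ·))(n) dρ` with `ν ≈ π s`). [folklore] -/
theorem lorentzGain_radial (v : EuclideanSpace ℝ (Fin 3)) {f : ℝ → ℝ} (hf : Measurable f) :
    lorentzGain (fun x => f ‖x‖) v = π * ‖v‖ * (2 * ∫ ρ in (0:ℝ)..1, 2 * ρ * f (ρ * ‖v‖)) := by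
  rw [← gain_zero_eq_lorentzGain v (show Measurable (fun x => f ‖x‖) from hf.comp measurable_norm),
    gainFst_zero_radial v hf, gainSnd_zero_radial v hf]
  ring

/-- **`lorentzGain (‖·‖^α) v = λ₀(α) π ‖v‖^{α+1}`, `λ₀(α) = 4/(α+2)`** (`-1 < α`, real powers): the far-field
gain acts diagonally on radial powers with the monopole indicial multiplier of `…T12Indicial`
(`∫₀¹ 2ρ · 2ρ^α dρ = 4/(α+2)`, `integral_two_mul_mul_rpow`). [folklore] -/
theorem lorentzGain_rpow {α : ℝ} (hα : -1 < α) (v : EuclideanSpace ℝ (Fin 3)) :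
    lorentzGain (fun x => ‖x‖ ^ α) v = 4 / (α + 2) * π * ‖v‖ ^ (α + 1) := by
  rw [lorentzGain_radial v (f := fun r : ℝ => r ^ α) (measurable_id.pow_const α)]
  have h1 : ∫ ρ in (0:ℝ)..1, 2 * ρ * (ρ * ‖v‖) ^ α = ‖v‖ ^ α * (2 / (α + 2)) := by
    rw [← (integral_two_mul_mul_rpow hα).2, ← intervalIntegral.integral_const_mul]
    refine intervalIntegral.integral_congr fun ρ hρ => ?_
    rw [uIcc_of_le zero_le_one] at hρ
    rw [mul_rpow hρ.1 (norm_nonneg v)]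
    ring
  rw [h1, rpow_add_one' (norm_nonneg v) (by linarith)]
  have hα2 : α + 2 ≠ 0 := by linarith
  field_simp
  ring

/-- **Mass of the far-field step: `lorentzGain 1 v = 2π‖v‖`** (`λ₀(0) = 2`; `K₂1 = 2ν` to leading order,
the first entry of the resonance table). [folklore] -/
theorem lorentzGain_one (v : EuclideanSpace ℝ (Fin 3)) : lorentzGain (fun _ => (1:ℝ)) v = 2 * π * ‖v‖ := by
  rw [lorentzGain_radial v (f := fun _ : ℝ => (1:ℝ)) measurable_const]
  have h : ∫ ρ in (0:ℝ)..1, 2 * ρ * 1 = 1 := by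
    simp_rw [mul_one]
    rw [intervalIntegral.integral_const_mul, integral_id]
    norm_num
  rw [h]
  ring

/-- **First moment of the far-field step: `lorentzGain ‖·‖ v = (4/3)π‖v‖²`** (`λ₀(1) = 4/3`, the second
entry of the resonance table: one far-field step EXPANDS the linear radial weight by `4/3 > 1`). [folklore] -/
theorem lorentzGain_norm (v : EuclideanSpace ℝ (Fin 3)) : lorentzGain (fun x => ‖x‖) v = 4 / 3 * π * ‖v‖ ^ 2 := by
  rw [lorentzGain_radial v (f := fun r : ℝ => r) measurable_id]
  have h : ∫ ρ in (0:ℝ)..1, 2 * ρ * (ρ * ‖v‖) = 2 / 3 * ‖v‖ := by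
    have : (fun ρ : ℝ => 2 * ρ * (ρ * ‖v‖)) = fun ρ : ℝ => 2 * ‖v‖ * ρ ^ 2 := by
      funext ρ; ring
    rw [this, intervalIntegral.integral_const_mul, integral_pow]
    norm_num
    ring
  rw [h]
  ring

/-- **The affine radial weight**: `lorentzGain (1 + ‖·‖) v = 2π‖v‖ + (4/3)π‖v‖² = π‖v‖ (2 + (4/3)‖v‖)`. [folklore] -/
theorem lorentzGain_one_add_norm (v : EuclideanSpace ℝ (Fin 3)) :
    lorentzGain (fun x => 1 + ‖x‖) v = π * ‖v‖ * (2 + 4 / 3 * ‖v‖) := by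
  rw [lorentzGain_radial v (f := fun r : ℝ => 1 + r) (measurable_const.add measurable_id)]
  have h : ∫ ρ in (0:ℝ)..1, 2 * ρ * (1 + ρ * ‖v‖) = 1 + 2 / 3 * ‖v‖ := by
    have : (fun ρ : ℝ => 2 * ρ * (1 + ρ * ‖v‖)) = fun ρ : ℝ => 2 * ρ + 2 * ‖v‖ * ρ ^ 2 := by
      funext ρ; ring
    have i1 : IntervalIntegrable (fun ρ : ℝ => 2 * ρ) volume 0 1 := by
      apply Continuous.intervalIntegrable; fun_prop
    have i2 : IntervalIntegrable (fun ρ : ℝ => 2 * ‖v‖ * ρ ^ 2) volume 0 1 := by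
      apply Continuous.intervalIntegrable; fun_prop
    rw [this, intervalIntegral.integral_add i1 i2, intervalIntegral.integral_const_mul,
      intervalIntegral.integral_const_mul, integral_id, integral_pow]
    norm_num
    ring
  rw [h]
  ring

/-! ### Positivity, monotonicity, linearity -/

/-- **Positivity**: `u ≥ 0 ⟹ lorentzGain u v ≥ 0` (no integrability needed). [folklore] -/
theorem lorentzGain_nonneg (v : EuclideanSpace ℝ (Fin 3)) (hu : ∀ x, 0 ≤ u x) : 0 ≤ lorentzGain u v :=
  mul_nonneg (norm_nonneg _) (add_nonneg (integral_nonneg fun _ => hu _) (integral_nonneg fun _ => hu _))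

/-- **Monotonicity**: `u ≤ u'` pointwise (both measurable and bounded on bounded sets) ⟹
`lorentzGain u v ≤ lorentzGain u' v`. [folklore] -/
theorem lorentzGain_mono (v : EuclideanSpace ℝ (Fin 3)) (hle : ∀ x, u x ≤ u' x) (hu : Measurable u)
    (hb : ∀ R : ℝ, ∃ C : ℝ, ∀ x, ‖x‖ ≤ R → |u x| ≤ C) (hu' : Measurable u')
    (hb' : ∀ R : ℝ, ∃ C : ℝ, ∀ x, ‖x‖ ≤ R → |u' x| ≤ C) : lorentzGain u v ≤ lorentzGain u' v :=
  mul_le_mul_of_nonneg_left (add_le_add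
    (integral_mono (integrableOn_comp_thalesFst v hu hb) (integrableOn_comp_thalesFst v hu' hb') fun _ => hle _)
    (integral_mono (integrableOn_comp_thalesSnd v hu hb) (integrableOn_comp_thalesSnd v hu' hb') fun _ => hle _))
    (norm_nonneg _)

/-- **Triangle inequality**: `|lorentzGain u v| ≤ lorentzGain |u| v` (no integrability needed). [folklore] -/
theorem abs_lorentzGain_le (v : EuclideanSpace ℝ (Fin 3)) : |lorentzGain u v| ≤ lorentzGain (fun x => |u x|) v := by
  unfold lorentzGain
  rw [abs_mul, abs_norm]
  exact mul_le_mul_of_nonneg_left ((abs_add_le _ _).trans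
    (add_le_add abs_integral_le_integral_abs abs_integral_le_integral_abs)) (norm_nonneg _)

/-- **Homogeneity**: `lorentzGain (c u) v = c · lorentzGain u v` (no integrability needed). [folklore] -/
theorem lorentzGain_const_mul (c : ℝ) (v : EuclideanSpace ℝ (Fin 3)) :
    lorentzGain (fun x => c * u x) v = c * lorentzGain u v := by
  unfold lorentzGain
  rw [integral_const_mul, integral_const_mul]
  ring

/-- **Additivity**: `lorentzGain (u + u') v = lorentzGain u v + lorentzGain u' v` for `u, u'` measurable and
bounded on bounded sets. [folklore] -/
theorem lorentzGain_add (v : EuclideanSpace ℝ (Fin 3)) (hu : Measurable u)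
    (hb : ∀ R : ℝ, ∃ C : ℝ, ∀ x, ‖x‖ ≤ R → |u x| ≤ C) (hu' : Measurable u')
    (hb' : ∀ R : ℝ, ∃ C : ℝ, ∀ x, ‖x‖ ≤ R → |u' x| ≤ C) :
    lorentzGain (fun x => u x + u' x) v = lorentzGain u v + lorentzGain u' v := by
  unfold lorentzGain
  rw [integral_add (integrableOn_comp_thalesFst v hu hb) (integrableOn_comp_thalesFst v hu' hb'),
    integral_add (integrableOn_comp_thalesSnd v hu hb) (integrableOn_comp_thalesSnd v hu' hb')]
  ring

/-- **The weighted bound**: `|u(x)| ≤ m(1 + ‖x‖)` for all `x` (and `u` measurable) ⟹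
`|lorentzGain u v| ≤ π‖v‖·m·(2 + (4/3)‖v‖)` = `m · lorentzGain (1 + ‖·‖) v`. [folklore] -/
theorem abs_lorentzGain_le_of_linearGrowth (v : EuclideanSpace ℝ (Fin 3)) (hu : Measurable u) {m : ℝ}
    (hm : ∀ x, |u x| ≤ m * (1 + ‖x‖)) : |lorentzGain u v| ≤ π * ‖v‖ * m * (2 + 4 / 3 * ‖v‖) := by
  obtain ⟨hm0, hb⟩ := locBdd_of_linearGrowth hm
  have hbabs : ∀ R : ℝ, ∃ C : ℝ, ∀ x, ‖x‖ ≤ R → |(fun x => |u x|) x| ≤ C := fun R => by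
    obtain ⟨C, hC⟩ := hb R
    exact ⟨C, fun x hx => by rw [abs_abs]; exact hC x hx⟩
  have hbw : ∀ R : ℝ, ∃ C : ℝ, ∀ x : EuclideanSpace ℝ (Fin 3), ‖x‖ ≤ R → |m * (1 + ‖x‖)| ≤ C := fun R =>
    ⟨m * (1 + R), fun x hx => by rw [abs_of_nonneg (by positivity)]; gcongr⟩
  calc |lorentzGain u v| ≤ lorentzGain (fun x => |u x|) v := abs_lorentzGain_le v
    _ ≤ lorentzGain (fun x => m * (1 + ‖x‖)) v :=
        lorentzGain_mono v hm (by fun_prop) hbabs (by fun_prop) hbw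
    _ = π * ‖v‖ * m * (2 + 4 / 3 * ‖v‖) := by
        rw [lorentzGain_const_mul (u := fun x => 1 + ‖x‖), lorentzGain_one_add_norm]
        ring

/-! ### Registered helpers -/

/-- **Registered helper `t12_lorentzGain_rpow` — the far-field gain operator on radial powers.** For
`-1 < α` and every `v ∈ ℝ³` (`E_v := Lambert.embed (‖v‖⁻¹ • v)`, `p ∈ ℝ²` Lebesgue on the unit disc):
`‖v‖ (∫_{‖p‖<1} ‖‖p‖² v - ‖v‖√(1-‖p‖²) E_v p‖^α dp + ∫_{‖p‖<1} ‖(1-‖p‖²) v + ‖v‖√(1-‖p‖²) E_v p‖^α dp) = (4/(α+2)) π ‖v‖^{α+1}`,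
i.e. `lorentzGain (‖·‖^α) v = λ₀(α) · π‖v‖ · ‖v‖^α` with the monopole indicial multiplier `λ₀(α) = 4/(α+2)`
of the resonance table (`t12_indicial_ell0`): the far-field (Lorentz-gas, partner at rest) gain term of the
linearised hard-sphere operator acts DIAGONALLY on radial powers; `α = 0`: mass `2π‖v‖` (`K₂1 ≈ 2ν`);
`α = 1`: `(4/3)π‖v‖²` (`λ₀(1) = 4/3 > 1`, no positive supersolution of linear growth); `α = 2`: `π‖v‖³ = ν·‖v‖²`
to leading order (the energy invariant). FACT F of the corrector-growth plan of the line `birth`. [folklore] -/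
theorem t12_lorentzGain_rpow : ∀ α : ℝ, -1 < α → ∀ v : EuclideanSpace ℝ (Fin 3), ‖v‖ * ((∫ p in Metric.ball (0 : EuclideanSpace ℝ (Fin 2)) 1, ‖(‖p‖ ^ 2) • v - (‖v‖ * Real.sqrt (1 - ‖p‖ ^ 2)) • Literature.Analysis.FluidPDE.Lambert.embed (‖v‖⁻¹ • v) p‖ ^ α) + ∫ p in Metric.ball (0 : EuclideanSpace ℝ (Fin 2)) 1, ‖(1 - ‖p‖ ^ 2) • v + (‖v‖ * Real.sqrt (1 - ‖p‖ ^ 2)) • Literature.Analysis.FluidPDE.Lambert.embed (‖v‖⁻¹ • v) p‖ ^ α) = 4 / (α + 2) * Real.pi * ‖v‖ ^ (α + 1) :=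
  fun _ hα v => lorentzGain_rpow hα v

/-- **Registered helper `t12_lorentzGain_abs_le` — the weighted sup bound of the far-field gain operator.**
For `u : ℝ³ → ℝ` measurable with `|u(x)| ≤ m(1 + ‖x‖)` and every `v`:
`|‖v‖ (∫_{‖p‖<1} u(‖p‖² v - ‖v‖√(1-‖p‖²) E_v p) dp + ∫_{‖p‖<1} u((1-‖p‖²) v + ‖v‖√(1-‖p‖²) E_v p) dp)| ≤ π‖v‖ · m · (2 + (4/3)‖v‖)`,
i.e. `|lorentzGain u v| ≤ m · lorentzGain (1 + ‖·‖) v` with the sharp structure `π s m · 2∫₀¹ 2ρ(1 + ρ s) dρ`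
(mass `2 = λ₀(0)`, first moment `4/3 = λ₀(1)`): positivity of the far-field step and the first two entries of
the resonance table. With `ν(v) ≥ π‖v‖` this is `‖ν⁻¹ K₂^∞‖ ≤ 4/3 + 2/s` on the weighted space
`sup |u|/(1 + ‖v‖)` of the `ℓ ≥ 2` scheme (plan §6). [folklore] -/
theorem t12_lorentzGain_abs_le : ∀ (u : EuclideanSpace ℝ (Fin 3) → ℝ) (m : ℝ), Measurable u → (∀ x, |u x| ≤ m * (1 + ‖x‖)) → ∀ v : EuclideanSpace ℝ (Fin 3), |‖v‖ * ((∫ p in Metric.ball (0 : EuclideanSpace ℝ (Fin 2)) 1, u ((‖p‖ ^ 2) • v - (‖v‖ * Real.sqrt (1 - ‖p‖ ^ 2)) • Literature.Analysis.FluidPDE.Lambert.embed (‖v‖⁻¹ • v) p)) + ∫ p in Metric.ball (0 : EuclideanSpace ℝ (Fin 2)) 1, u ((1 - ‖p‖ ^ 2) • v + (‖v‖ * Real.sqrt (1 - ‖p‖ ^ 2)) • Literature.Analysis.FluidPDE.Lambert.embed (‖v‖⁻¹ • v) p))| ≤ Real.pi * ‖v‖ * m * (2 + 4 / 3 * ‖v‖)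 :=
  fun _ _ hu hm v => abs_lorentzGain_le_of_linearGrowth v hu hm

end Summit.AtomisticToContinuum.HydrodynamicLimit.Theorems.ClampedCorrectorBirth

end
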